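import Literature.AnabelianGeometry.EtaleTheta.Discharge.Sec2Cor29Model
import Literature.AnabelianGeometry.EtaleTheta.Discharge.Sec2Rmk261OfSetting
import Mathlib.GroupTheory.Subgroup.Centralizer
import HarnessLib

/-!
# [EtTh] §2 at the §1 model: `Π^tp_C` IS SLIM, granted that `Π^tp_X` is slim and that the inversion acts by
# `−1` on `Δ̄^ell_X` (proof-only companion; the binder `hslim : IsSlimGroup Π^tp_C` of Rmk. 2.6.1 (dotted) /
# Cor. 2.9 at the model DISCHARGED to the slimness of `Π^tp_X`)

Mochizuki, *The étale theta function and its Frobenioid-theoretic manifestations*, Publ. RIMS **45**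
(2009), §2: Def. 2.1 / Rmk. 2.1.1 p. 36 ("`ι` acts on `Q` by multiplication by `−1`"), Prop. 2.4 p. 38,
Rmk. 2.6.1 p. 40, Cor. 2.9 p. 43 [cite: MochizukiEtTh2009, Rmk 2.6.1 p.40]; slimness of tempered fundamental
groups of hyperbolic orbicurves: [SemiAnbd] §3 (Ex. 3.10, Cor. 3.11), [FrdI] §0 p. 13 (`IsSlimGroup`).

Cell abc-iut, layer L2, seat abc-iut-L2-d3 (gen 5); W3-L2-02 residue. PROOF-ONLY (0 defs, no new `Prop` fact).
The dotted clauses of [EtTh] Rmk. 2.6.1 and the six-member Cor. 2.9 at the arithmetic model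
(abc-iut-f-144's `rmk261_dotted_ofSetting`, this seat's `temperedCoverData_cor29_card'`) carried the binder
`hslim : IsSlimGroup M.GtpC` — slimness of the tempered fundamental group of the ORBICURVE `C = X/{±1}`, for which
the tree has no producer (abc-iut-L3's slimness results are for CURVES: `IsSlimGroup D.PiTemp`,
`TemperedCurveSlimOfTower.isSlimGroup_piTemp_of_tower`). This file derives it:

* (A) `MuTwoSetting.CLevelData.isSlimGroup_GtpC_of_not_centralizes` — pure topological group theory over the
  C-level datum (`Π^tp_X ↪ Π^tp_C` an open embedding with normal range): if `Π^tp_X` is slim and NO element of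
  `Π^tp_C ∖ Π^tp_X` centralises `Π^tp_X`, then `Π^tp_C` is slim (an element centralising an open `U` either lies
  in `Π^tp_X` — killed by slimness — or restricts to an automorphism `α` of `Π^tp_X` fixing the open
  `V := U ∩ Π^tp_X`, and then `y⁻¹·α(y)` centralises the open `V ∩ y⁻¹Vy` for every `y`, so `α = id`);
* (B) `MuTwoSetting.CLevelData.exists_conjX_ne` — at the model, NO element of `Π^tp_C ∖ Π^tp_X` centralises
  `Π^tp_X`, from the printed input P-C4 `hιell` ("`ι` acts by `−1` on `Δ̄^ell_X`", Rmk. 2.1.1; GAP-LEDGER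
  G-L2t10-4 (a), witnessed at abc-iut-w5-d072's inversion model) and `l` odd `≠ 1`: a centralising `g` would
  give `c := ιC(g)·y₀⁻¹ ∈ Δ_C ∖ Π_X` acting on `Δ̄^ell_X` like `y₀⁻¹ ∈ Π_X`, i.e. trivially modulo the line
  `Π_X̲ ∩ Δ_X` (`Π_X/Π_X̲ ≅ ℤ/l` is abelian), while `hιell` makes it act by `−1`; with `d^l ∈ Ker` this forces
  `Δ_X ≤ Π_X̲`, contradicting `[Π_X : Π_X̲] = l ≠ 1`;
* (C) **`MuTwoSetting.CLevelData.isSlimGroup_GtpC`** — `Π^tp_C` is slim ⟸ {`IsSlimGroup Π^tp_X`, `hιell`,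
  `l` odd `≠ 1`}; and the consumers with `hslim` DISCHARGED: `rmk261_dotted_ofSetting_of_slimX`
  (Rmk. 2.6.1 dotted, FACT-LIST F-0613 instance form, now modulo {`IsSlimGroup Π^tp_X`, Prop. 2.6}) and
  `temperedCoverData_cor29_card_of_slimX` (Cor. 2.9 at the model modulo {`IsSlimGroup Π^tp_X`, Prop. 2.6
  (F-0610), [SemiAnbd] Thm. 6.5 (ii)/(iii) (F-1658/F-1674), «unique cusp», compact `D_x`}).

HONEST FRAMING: nothing asserts that a `MuTwoSetting`, a `CLevelData` exists or that `Π^tp_X` is slim for an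
actual curve (that is abc-iut-L3's [SemiAnbd] fact, taken BY NAME); [EtTh]/[SemiAnbd] are refereed; no side is
taken on [IUTchIII] Cor. 3.12; typed ≠ proved elsewhere.
-/

namespace Literature.AnabelianGeometry.EtaleTheta

open Literature.AnabelianGeometry.SemiGraphs ThetaCovers
open Literature.AlgebraicGeometry.Frobenioids (IsSlimGroup)
open _root_.Topology

namespace MuTwoSetting.CLevelData

variable {p : ℕ} [Fact p.Prime] {M : MuTwoSetting p}

/-! ### (A) Slimness of `Π^tp_C` from slimness of `Π^tp_X` and "the inversion is outer" -/

/-- An element of `Π^tp_C` commuting with `inclX(y)` for all `y` in a subgroup `V ≤ Π^tp_X` acts trivially on `V`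
through `conjX`. [cite: MochizukiEtTh2009, Prop 1.8 p.28] -/
theorem conjX_eq_self_of_commute (e : M.CLevelData) {g : M.GtpC} {y : M.PiTemp}
    (h : M.inclX y * g = g * M.inclX y) : e.conjX g y = y :=
  M.injective_inclX (by rw [e.inclX_conjX, ← h, mul_inv_cancel_right])

/-- **`Π^tp_C` is slim if `Π^tp_X` is slim and no element of `Π^tp_C ∖ Π^tp_X` centralises `Π^tp_X`** (pure
topological group theory over the open embedding `inclX` with normal range).
[cite: MochizukiEtTh2009, Prop 2.4 p.38] -/
theorem isSlimGroup_GtpC_of_not_centralizes (e : M.CLevelData) (hX : IsSlimGroup M.PiTemp)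
    (hout : ∀ g : M.GtpC, g ∉ M.inclX.range → ∃ y : M.PiTemp, e.conjX g y ≠ y) : IsSlimGroup M.GtpC := by
  refine ⟨fun U hU => ?_⟩
  rw [eq_bot_iff]
  intro g hg
  rw [Subgroup.mem_centralizer_iff] at hg
  -- `V := inclX⁻¹(U)`, open in `Π^tp_X`, on which `conjX g` is the identity
  set V : Subgroup M.PiTemp := U.comap M.inclX with hV
  have hVo : IsOpen (V : Set M.PiTemp) := hU.preimage M.continuous_inclX
  have hαV : ∀ v ∈ V, e.conjX g v = v := fun v hv => e.conjX_eq_self_of_commute (hg _ hv)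
  by_cases hgr : g ∈ M.inclX.range
  · -- `g = inclX h` with `h ∈ Z_{Π^tp_X}(V) = 1`
    obtain ⟨h, rfl⟩ := hgr
    have hh : h ∈ Subgroup.centralizer (V : Set M.PiTemp) := by
      rw [Subgroup.mem_centralizer_iff]
      intro v hv
      have := hαV v hv
      rw [e.conjX_inclX] at this
      calc v * h = h * v * h⁻¹ * h := by rw [this]
        _ = h * v := by group
    rw [hX.centralizer_eq_bot V hVo] at hh
    rw [Subgroup.mem_bot] at hh ⊢
    rw [hh, map_one]
  · -- `g ∉ Π^tp_X`: `conjX g` fixes `V`, hence all of `Π^tp_X` by slimness — contradiction with `hout`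
    exfalso
    obtain ⟨y, hy⟩ := hout g hgr
    apply hy
    set α := e.conjX g with hα
    -- `W := V ∩ y⁻¹ V y`, open; `y⁻¹ α(y)` centralises it
    set W : Subgroup M.PiTemp := V ⊓ V.comap (MulAut.conj y).toMonoidHom with hW
    have hWo : IsOpen (W : Set M.PiTemp) := by
      refine hVo.inter (hVo.preimage ?_)
      exact (continuous_const.mul continuous_id).mul continuous_const
    have hc : y⁻¹ * α y ∈ Subgroup.centralizer (W : Set M.PiTemp) := by
      rw [Subgroup.mem_centralizer_iff]
      rintro w ⟨hwV, hwV'⟩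
      have hwV' : y * w * y⁻¹ ∈ V := hwV'
      have h1 : α (y * w * y⁻¹) = y * w * y⁻¹ := hαV _ hwV'
      have h2 : α w = w := hαV _ hwV
      rw [map_mul, map_mul, map_inv, h2] at h1
      -- `α y * w * (α y)⁻¹ = y * w * y⁻¹`
      calc w * (y⁻¹ * α y) = y⁻¹ * (y * w * y⁻¹) * α y := by group
        _ = y⁻¹ * (α y * w * (α y)⁻¹) * α y := by rw [h1]
        _ = y⁻¹ * α y * w := by group
    rw [hX.centralizer_eq_bot W hWo, Subgroup.mem_bot] at hc
    calc α y = y * (y⁻¹ * α y) := by group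
      _ = y := by rw [hc, mul_one]

/-! ### (B) At the model: no element of `Π^tp_C ∖ Π^tp_X` centralises `Π^tp_X` -/

section Model

variable {PC : Type} [Group PC] [TopologicalSpace PC] [IsTopologicalGroup PC] [T2Space PC]

/-- If `g ∈ Π^tp_C` acts trivially on `Π^tp_X` by conjugation, then `ιC(g)` centralises the profinite
`Π_X = cl(ιC(inclX(Π^tp_X)))` inside `P_C` (centralisers are closed). [cite: MochizukiEtTh2009, Prop 2.4 p.38] -/
theorem incl_range_le_centralizer_of_conjX_eq (e : M.CLevelData) (ιC : M.GtpC →ₜ* PC)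
    (hιC : IsProfiniteCompletion ιC) {g : M.GtpC} (hg : ∀ y : M.PiTemp, e.conjX g y = y) :
    ∀ z ∈ (e.piCDataOf ιC hιC).PiX, z * ιC g = ιC g * z := by
  -- the closed subgroup `Z(ιC g)` contains `ιC(inclX(Π^tp_X))`, hence its closure `Π_X = range Φ`
  have hcl : IsClosed ((Subgroup.centralizer ({ιC g} : Set PC) : Subgroup PC) : Set PC) := by
    have : ((Subgroup.centralizer ({ιC g} : Set PC) : Subgroup PC) : Set PC) =
        {z : PC | ιC g * z = z * ιC g} := by
      ext z
      simp only [SetLike.mem_coe, Subgroup.mem_centralizer_iff, Set.mem_singleton_iff, forall_eq,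
        Set.mem_setOf_eq]
    rw [this]
    exact isClosed_eq (continuous_const.mul continuous_id) (continuous_id.mul continuous_const)
  have hle : (((⊤ : Subgroup M.PiTemp).map M.inclX).map ιC.toMonoidHom).topologicalClosure ≤
      Subgroup.centralizer ({ιC g} : Set PC) := by
    refine Subgroup.topologicalClosure_minimal _ ?_ hcl
    rintro _ ⟨_, ⟨y, -, rfl⟩, rfl⟩
    rw [Subgroup.mem_centralizer_iff]
    intro c hc
    rw [Set.mem_singleton_iff] at hc
    subst hc
    show ιC g * ιC (M.inclX y) = ιC (M.inclX y) * ιC g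
    rw [← map_mul, ← map_mul]
    congr 1
    have := e.inclX_conjX g y
    rw [hg y] at this
    calc g * M.inclX y = g * M.inclX y * g⁻¹ * g := by group
      _ = M.inclX y * g := by rw [← this]
  intro z hz
  -- `z ∈ Π_X = closure of ιC(inclX(Π^tp_X))`
  have hz' : z ∈ (((⊤ : Subgroup M.PiTemp).map M.inclX).map ιC.toMonoidHom).topologicalClosure := by
    have hzr : z ∈ Set.range (e.piCDataOf ιC hιC).incl := by
      obtain ⟨w, rfl⟩ := hz; exact ⟨w, rfl⟩
    rw [range_hatInclX_eq_closure ιC hιC (e.piCDataOf ιC hιC).incl (e.piCDataOf_incl_toHat ιC hιC)] at hzr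
    have hset : ιC '' ((M.inclX.range : Subgroup M.GtpC) : Set M.GtpC) =
        ((((⊤ : Subgroup M.PiTemp).map M.inclX).map ιC.toMonoidHom : Subgroup PC) : Set PC) := by
      ext w
      simp only [Set.mem_image, SetLike.mem_coe, MonoidHom.mem_range, Subgroup.mem_map, Subgroup.mem_top,
        true_and, ContinuousMonoidHom.coe_toMonoidHom]
      constructor
      · rintro ⟨u, ⟨y, rfl⟩, rfl⟩; exact ⟨M.inclX y, ⟨y, rfl⟩, rfl⟩
      · rintro ⟨u, ⟨y, rfl⟩, rfl⟩; exact ⟨M.inclX y, ⟨y, rfl⟩, rfl⟩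
    rw [hset] at hzr
    exact hzr
  have := (hle hz')
  rw [Subgroup.mem_centralizer_iff] at this
  exact (this (ιC g) (Set.mem_singleton _)).symm

/-- **No element of `Π^tp_C ∖ Π^tp_X` centralises `Π^tp_X`** at the model, from P-C4 `hιell` ("`ι` acts by `−1`
on `Δ̄^ell_X`") and `l` odd `≠ 1`: a centralising `g` yields `c := ιC(g)·y₀⁻¹ ∈ Δ_C ∖ Π_X` acting on `Δ_X`
modulo `Π_X̲` trivially (`Π_X/Π_X̲ ≅ ℤ/l` abelian) yet by `−1` modulo `Δ̄_Θ`-preimage, forcing `Δ_X ≤ Π_X̲`.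
[cite: MochizukiEtTh2009, Rmk 2.1.1 p.36] -/
theorem exists_conjX_ne (e : M.CLevelData) (ιC : M.GtpC →ₜ* PC) (hιC : IsProfiniteCompletion ιC)
    (op : M.toThetaSetting.OncePuncturedData) {l : ℕ} (hodd : Odd l) (hl : l ≠ 1)
    (hιell : ∀ c ∈ (e.piCDataOf ιC hιC).augGK.ker, c ∉ (e.piCDataOf ιC hιC).PiX →
      ∀ d ∈ (e.piCDataOf ιC hιC).PiX ⊓ (e.piCDataOf ιC hιC).augGK.ker,
        c * d * c⁻¹ * d ∈ (e.piCDataOf ιC hιC).barTheta l)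
    (g : M.GtpC) (hgr : g ∉ M.inclX.range) : ∃ y : M.PiTemp, e.conjX g y ≠ y := by
  haveI : NeZero l := ⟨by obtain ⟨k, hk⟩ := hodd; omega⟩
  by_contra hall
  have hall : ∀ y : M.PiTemp, e.conjX g y = y := fun y => by
    by_contra h
    exact hall ⟨y, h⟩
  set I := e.piCDataOf ιC hιC with hI
  set Hu := (((M.GtpXu l).map M.inclX).map ιC.toMonoidHom).topologicalClosure with hHu
  -- `c₀ := ιC g ∉ Π_X` centralises `Π_X`
  have hc₀X : ιC g ∉ I.PiX := fun h =>
    hgr ((mem_range_hatInclX_iff ιC hιC I.incl (e.piCDataOf_incl_toHat ιC hιC) g).1 h)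
  have hcomm := e.incl_range_le_centralizer_of_conjX_eq ιC hιC hall
  -- `y₀ ∈ Π_X` with `aug y₀ = aug (ιC g)`; `c := ιC g · y₀⁻¹ ∈ Δ_C ∖ Π_X`
  obtain ⟨⟨y₀, hy₀⟩, hya⟩ := I.augGK_PiX_surjective (I.augGK (ιC g))
  have hya : I.augGK y₀ = I.augGK (ιC g) := hya
  set c := ιC g * y₀⁻¹ with hc
  have hcK : c ∈ I.augGK.ker := by
    rw [MonoidHom.mem_ker, hc, map_mul, map_inv, hya, mul_inv_cancel]
  have hcX : c ∉ I.PiX := fun h => hc₀X (by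
    have := Subgroup.mul_mem _ h hy₀
    rwa [hc, inv_mul_cancel_right] at this)
  -- the quotient `Π_X ↠ ℤ/l` with kernel `Π_X̲` kills commutators
  obtain ⟨φ, -, hφ⟩ := e.exists_quot_closureXu ιC hιC l
  have hΔle : I.PiX ⊓ I.augGK.ker ≤ Hu := by
    intro d hd
    -- `a := y₀⁻¹ d y₀`; `a·d ∈ barTheta ≤ Hu` (by `hιell`, as `c` centralises through `ιC g`)
    have hconj : c * d * c⁻¹ = y₀⁻¹ * d * y₀ := by
      have h1 : y₀⁻¹ * d * y₀ ∈ I.PiX :=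
        Subgroup.mul_mem _ (Subgroup.mul_mem _ (Subgroup.inv_mem _ hy₀) hd.1) hy₀
      have h2 := hcomm _ h1
      rw [hc]
      calc ιC g * y₀⁻¹ * d * (ιC g * y₀⁻¹)⁻¹ = ιC g * (y₀⁻¹ * d * y₀) * (ιC g)⁻¹ := by group
        _ = (y₀⁻¹ * d * y₀) * ιC g * (ιC g)⁻¹ := by rw [← h2]
        _ = y₀⁻¹ * d * y₀ := by group
    have had : y₀⁻¹ * d * y₀ * d ∈ Hu := by
      have := hιell c hcK hcX d hd
      rw [hconj] at this
      exact e.barTheta_le_closureXu ιC hιC op l this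
    -- `a·d⁻¹ = [y₀⁻¹, d] ∈ Hu` (the quotient by `Hu` is abelian)
    have had' : y₀⁻¹ * d * y₀ * d⁻¹ ∈ Hu := by
      have hmem : (⟨y₀⁻¹ * d * y₀ * d⁻¹, Subgroup.mul_mem _ (Subgroup.mul_mem _ (Subgroup.mul_mem _
          (Subgroup.inv_mem _ hy₀) hd.1) hy₀) (Subgroup.inv_mem _ hd.1)⟩ : ↥I.PiX) ∈ φ.ker := by
        rw [MonoidHom.mem_ker]
        have : (⟨y₀⁻¹ * d * y₀ * d⁻¹, _⟩ : ↥I.PiX) =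
            (⟨y₀, hy₀⟩ : ↥I.PiX)⁻¹ * ⟨d, hd.1⟩ * ⟨y₀, hy₀⟩ * (⟨d, hd.1⟩ : ↥I.PiX)⁻¹ := rfl
        rw [this, map_mul, map_mul, map_mul, map_inv, map_inv, mul_comm (φ ⟨y₀, hy₀⟩)⁻¹,
          mul_assoc, mul_assoc, inv_mul_cancel_left, mul_inv_cancel]
      exact (hφ _).1 ((MonoidHom.mem_ker).1 hmem)
    -- hence `d² ∈ Hu`, and `d^l ∈ Ker ≤ Hu`; `l` odd ⇒ `d ∈ Hu`
    have hd2 : d * d ∈ Hu := by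
      have := Subgroup.mul_mem _ (Subgroup.inv_mem _ had') had
      have heq : (y₀⁻¹ * d * y₀ * d⁻¹)⁻¹ * (y₀⁻¹ * d * y₀ * d) = d * d := by group
      rwa [heq] at this
    have hdl : d ^ l ∈ Hu :=
      e.barTheta_le_closureXu ιC hιC op l (I.barKer_le_barTheta l op (I.pow_mem_barKer l op hd))
    obtain ⟨k, hk⟩ := hodd
    have hpow : d ^ l = (d * d) ^ k * d := by
      rw [hk, pow_succ, pow_mul, sq]
    have : d = ((d * d) ^ k)⁻¹ * d ^ l := by rw [hpow]; group
    rw [this]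
    exact Subgroup.mul_mem _ (Subgroup.inv_mem _ (Subgroup.pow_mem _ hd2 k)) hdl
  -- so `Π_X = Hu ⊔ Δ_X ≤ Hu`, contradicting `[P_C : Hu] = 2l ≠ 2 = [P_C : Π_X]`
  have hPiX : I.PiX ≤ Hu := by
    rw [← e.closureXu_sup_deltaX ιC hιC l]
    exact sup_le le_rfl hΔle
  have hEq : Hu = I.PiX := le_antisymm (e.closureXu_le_PiX ιC hιC l) hPiX
  have h1 : Hu.index = 2 * l := e.index_closureXu ιC hιC (NeZero.ne l)
  have h2 : I.PiX.index = 2 := I.index_range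
  rw [hEq, h2] at h1
  omega

/-! ### (C) The assembly and the consumers with `hslim` discharged -/

/-- **`Π^tp_C` IS SLIM** at the [EtTh] §1/§2 model, granted the slimness of `Π^tp_X` ([SemiAnbd] §3, BY NAME)
and the printed input P-C4 `hιell` (`ι` acts by `−1` on `Δ̄^ell_X`), for `l` odd `≠ 1`.
[cite: MochizukiEtTh2009, Prop 2.4 p.38] -/
theorem isSlimGroup_GtpC (e : M.CLevelData) (ιC : M.GtpC →ₜ* PC) (hιC : IsProfiniteCompletion ιC)
    (op : M.toThetaSetting.OncePuncturedData) {l : ℕ} (hodd : Odd l) (hl : l ≠ 1)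
    (hιell : ∀ c ∈ (e.piCDataOf ιC hιC).augGK.ker, c ∉ (e.piCDataOf ιC hιC).PiX →
      ∀ d ∈ (e.piCDataOf ιC hιC).PiX ⊓ (e.piCDataOf ιC hιC).augGK.ker,
        c * d * c⁻¹ * d ∈ (e.piCDataOf ιC hιC).barTheta l)
    (hX : IsSlimGroup M.PiTemp) : IsSlimGroup M.GtpC :=
  e.isSlimGroup_GtpC_of_not_centralizes hX (e.exists_conjX_ne ιC hιC op hodd hl hιell)

/-- **[EtTh] Rmk. 2.6.1, dotted clauses, at the model with `hslim` DISCHARGED** (abc-iut-f-144's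
`rmk261_dotted_ofSetting`, FACT-LIST F-0613 instance form): residual = {`IsSlimGroup Π^tp_X`, Prop. 2.6}.
[cite: MochizukiEtTh2009, Rmk 2.6.1 p.40] -/
theorem rmk261_dotted_ofSetting_of_slimX (e : M.CLevelData) (ιC : M.GtpC →ₜ* PC)
    (hιC : IsProfiniteCompletion ιC) (hinj : Function.Injective ιC) (op : M.toThetaSetting.OncePuncturedData)
    {l : ℕ} [NeZero l] (hodd : Odd l) (hl : l ≠ 1) {x : M.Pt} (hx : M.IsCusp x)
    (hIx : ((e.piCDataOf ιC hιC).Dx x ⊓ (e.piCDataOf ιC hιC).augGK.ker) ⊔ (e.piCDataOf ιC hιC).barKer l =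
      (e.piCDataOf ιC hιC).barTheta l)
    (hιell : ∀ c ∈ (e.piCDataOf ιC hιC).augGK.ker, c ∉ (e.piCDataOf ιC hιC).PiX →
      ∀ d ∈ (e.piCDataOf ιC hιC).PiX ⊓ (e.piCDataOf ιC hιC).augGK.ker,
        c * d * c⁻¹ * d ∈ (e.piCDataOf ιC hιC).barTheta l)
    (hN : ((M.GtpXu l).map M.inclX).Normal) (hY : (M.GtpY.map M.inclX).Normal) {S : Subgroup PC}
    (hS : ((e.piCDataOf ιC hιC).coverDataAx l op hx hodd hIx hιell
        ((e.piCDataOf ιC hιC).inv_theta_of_inv_ell l op hιell)).toCoverData.IsSplitting S)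
    (hSc : IsClosed (S : Set PC)) (hX : IsSlimGroup M.PiTemp)
    (h26 : (e.temperedCoverData ιC hιC hinj op hodd hx hIx hιell hN hY hS hSc).Prop26) :
    (e.temperedCoverData ιC hιC hinj op hodd hx hIx hιell hN hY hS hSc).Rmk261_dotted :=
  e.rmk261_dotted_ofSetting ιC hιC hinj op hodd hx hIx hιell hN hY hS hSc
    (e.isSlimGroup_GtpC ιC hιC op hodd hl hιell hX) h26

/-- **[EtTh] Cor. 2.9 (all six members) at the model with `hslim` DISCHARGED** (this seat's
`temperedCoverData_cor29_card'`): residual = {`IsSlimGroup Π^tp_X`, Prop. 2.6 (F-0610), [SemiAnbd] Thm. 6.5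
(ii)/(iii) (F-1658/F-1674), «`X^log` has a unique cusp», compact `D_x`} — all NAMED facts / origin clauses /
print-shaped data. [cite: MochizukiEtTh2009, Cor 2.9 p.43] -/
theorem temperedCoverData_cor29_card_of_slimX (e : M.CLevelData) (ιC : M.GtpC →ₜ* PC)
    (hιC : IsProfiniteCompletion ιC) (hinj : Function.Injective ιC) (op : M.toThetaSetting.OncePuncturedData)
    {l : ℕ} (hodd : Odd l) (hl : l ≠ 1) {x : M.Pt} (hx : M.IsCusp x)
    (hIx : ((e.piCDataOf ιC hιC).Dx x ⊓ (e.piCDataOf ιC hιC).augGK.ker) ⊔ (e.piCDataOf ιC hιC).barKer l =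
      (e.piCDataOf ιC hιC).barTheta l)
    (hιell : ∀ c ∈ (e.piCDataOf ιC hιC).augGK.ker, c ∉ (e.piCDataOf ιC hιC).PiX →
      ∀ d ∈ (e.piCDataOf ιC hιC).PiX ⊓ (e.piCDataOf ιC hιC).augGK.ker,
        c * d * c⁻¹ * d ∈ (e.piCDataOf ιC hιC).barTheta l)
    (hN : ((M.GtpXu l).map M.inclX).Normal) (hY : (M.GtpY.map M.inclX).Normal) {S : Subgroup PC}
    (hS : ((e.piCDataOf ιC hιC).coverDataAx l op hx hodd hIx hιell
        ((e.piCDataOf ιC hιC).inv_theta_of_inv_ell l op hιell)).toCoverData.IsSplitting S)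
    (hSc : IsClosed (S : Set PC)) (hX : IsSlimGroup M.PiTemp)
    (h26 : (e.temperedCoverData ιC hιC hinj op hodd hx hIx hιell hN hY hS hSc).Prop26)
    (hDc : IsCompact (M.decomp x : Set M.PiTemp)) (h65 : M.toTemperedCurve.DecompCommensurablyTerminal)
    (huniq : ∀ x' : M.Pt, M.IsCusp x' → x' = x)
    (h65iii : M.toTemperedCurve.IsoPreservesCuspidalDecomp M.toTemperedCurve) :
    (e.temperedCoverData ιC hιC hinj op hodd hx hIx hιell hN hY hS hSc).Cor29_card :=
  temperedCoverData_cor29_card' e ιC hιC hinj op hodd hx hIx hιell hN hY hS hSc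
    (e.isSlimGroup_GtpC ιC hιC op hodd hl hιell hX) h26 hDc h65 huniq h65iii

end Model

end MuTwoSetting.CLevelData

end Literature.AnabelianGeometry.EtaleTheta
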